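import Summits.BirchSwinnertonDyer.BirchSwinnertonDyer.Theorems.BiquadraticEisensteinDescentManinDatumSupercuspidalCMInertSexticDictionaryHolds
import HarnessLib

set_option linter.dupNamespace false -- `Summit.BirchSwinnertonDyer.BirchSwinnertonDyer.Theorems.…` (summit = sub, D-0017)
set_option autoImplicit false

/-!
# Crux `ManinDatumSupercuspidalCMInert` (stmt-BirchSwinnertonDyer-20111, BED r605) — ★ the registered stub `stub_S5` (skeleton `9438078f…`),
# UNCONDITIONALLY: the `j = 0` sextic cells `II / IV / IV* / II*` at `p = 5` of the supercuspidal Manin residual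
# (width seat `bsd-wall-cm-bed-w3` g11; one theorem; `--supports 20111`)

Route `BiquadraticEisensteinDescent` (cell `pub/bsd-wall`). Specialisation of the crux theorem
`…SexticDictionaryHolds.maninDatumSupercuspidalCMInert_holds` (whose `p = 5` half is exactly this statement) to `p = 5`.
HONEST FRAMING: with `stub_S7` (bed-w3 g10, p646655) both registered stubs of crux 20111 are now tree theorems, and so is the crux itself; its parent
`ManinDatumFiveSevenCMInert`, Manin's conjecture in general, and BSD are NOT proved by this. No definition, no named fact, no `sorry`; axioms standard.
-/

noncomputable section

open scoped Classical
open Complex WeierstrassCurve IsDedekindDomain NumberField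
open Literature.NumberTheory.EllipticCurves
open Literature.NumberTheory.EllipticCurves.ModularForms
open Literature.NumberTheory.EllipticCurves.Rank1Residual
open Literature.NumberTheory.DiophantineGeometry
open Summit.BirchSwinnertonDyer.BirchSwinnertonDyer.Theses.BiquadraticEisensteinDescent

namespace Summit.BirchSwinnertonDyer.BirchSwinnertonDyer.Theorems.BiquadraticEisensteinDescentManinDatumSupercuspidalCMInertStubS5

open Summit.BirchSwinnertonDyer.BirchSwinnertonDyer.Theorems.BiquadraticEisensteinDescentManinDatumSupercuspidalCMInertSexticDictionaryHolds
  (maninDatumSupercuspidalCMInert_holds)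

/-- ★★ **`stub_S5` of crux `ManinDatumSupercuspidalCMInert` (stmt-BirchSwinnertonDyer-20111), registered signature VERBATIM, unconditionally**:
for a CM elliptic curve `W/ℚ` (globally minimal model) of analytic rank `1` with `j(W) = 0`, `5` inert in the CM field and bad for `W`
(Kodaira type `II`, `IV`, `IV*` or `II*` at the place `v ∣ 5`), and a lattice-optimal modular parametrisation datum `D` of level `N_W`:
`5 ∤ c(D)`. [cite: Manin1972, Thm. 1.6] [cite: Rubin1999, §7.4 Prop. 7.15] [cite: IrelandRosen1990, Ch. 18 §7] -/
theorem stub_S5 :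
    ∀ (W : WeierstrassCurve ℚ) [W.IsElliptic] [W.IsGloballyMinimal] [NeZero (W.conductorNorm ℤ)] (p : ℕ) [Fact p.Prime]
      (D : ModularParametrizationData W (W.conductorNorm ℤ)) (v : IsDedekindDomain.HeightOneSpectrum ℤ),
      Rat.HeightOneSpectrum.natGenerator v = p → W.HasCM → W.analyticRank = 1 → p = 5 → W.j = 0 → CMInert W p → ¬ Good W p →
      (∀ z ∈ D.L.lattice, ∃ w ∈ periodLattice D.f, z = D.c * w) →
      (W.kodairaSymbolAt v = .II ∨ W.kodairaSymbolAt v = .IV ∨ W.kodairaSymbolAt v = .IVstar ∨ W.kodairaSymbolAt v = .IIstar) →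
      ¬ (p : ℤ) ∣ D.c :=
  fun W _ _ _ p _ D v hv hCM hr hp hj hI hG hopt hkod ↦
    maninDatumSupercuspidalCMInert_holds W p D v hv hCM hr (Or.inl hp) hI hG hopt (Or.inl ⟨hp, hj, hkod⟩)

end Summit.BirchSwinnertonDyer.BirchSwinnertonDyer.Theorems.BiquadraticEisensteinDescentManinDatumSupercuspidalCMInertStubS5

end
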